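import Mathlib.NumberTheory.Harmonic.ZetaAsymp
import Literature.NumberTheory.LFunctions.ZeroFreeRegionUpTo
import Literature.NumberTheory.LFunctions.DirichletLRiemannHypothesisUpTo
import Literature.NumberTheory.LFunctions.ExplicitZeroFreeRegionRoundsProofs
import HarnessLib

/-!
# Kadiri's explicit zero-free region `R = 5.60` for Dirichlet `L`-functions on Platt's certified
# range `q ≤ 4·10⁵`, and Bennett–Martin–O'Bryant–Rechnitzer's Hypothesis Z(10⁸/q, 5.6)

Topic `Literature/NumberTheory/LFunctions`; namespace `Literature.NumberTheory.LFunctions`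
(helper namespace `Kadiri2018ZFR`; consumer namespace `BMOR2018`, as in
`ExplicitPNTNonExceptionalModuli.lean`). Typed for the parity-realchar cell (column REALCHAR,
TARGET row 11 "Kadiri … Mathematika 64 (2018) 445–474: published version: non-principal primitive χ
with 3 ≤ q ≤ 4·10⁵, R = 5.60 — tree decl missing"; consumers C1 "exception-free explicit ZFR up to
Q"), statement-first (D-0064): ONE named fact AS PRINTED (`kadiri2018_theorem11`, D-0014, not
discharged — the printed proof is 20 pp. of explicit analysis closed by a certified numerical
iteration, size L), three definitions with bodies (Bennett–Martin–O'Bryant–Rechnitzer's Definition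
3.1: `BMOR2018.HypothesisZ`, `BMOR2018.ModulusHypothesisZ`, `BMOR2018.HypothesisZ₁`), and THEOREMS:
the INSTRUMENT PROVENANCE of both — Kadiri's region is extended from primitive to all non-principal
characters, combined with the Riemann zeta inputs of record into the column's
`ZeroFreeRegionUpTo 400000 5.60 M₀` (constant `9.645908801 → 5.60` on Platt's range), and
Bennett–Martin–O'Bryant–Rechnitzer's Proposition 4.34 ("Platt, Kadiri, Mossinghoff–Trudgian") is
DERIVED from the three certified-computation / explicit-region facts it quotes.

## What the sources print

* H. Kadiri, *Explicit zero-free regions for Dirichlet L-functions*, Mathematika **64** (2018)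
  445–474, doi:10.1112/S0025579318000037 [Kadiri2018]. TEXT OF RECORD for this file: the author's
  accepted version arXiv:math/0510570**v2** (4 Mar 2019; source file
  `explicit-zero-free-region-Dirichlet-L-functions-GRH-verif-Platt-Mathematika-Revision1-Nov2017.tex`,
  fetched 2026-08-28 into the seat folder `src/kadiri/v2/`), whose title, abstract and arXiv
  journal-ref are those of the Mathematika paper; the journal PDF itself is not held (acq-10983,
  coordinator ruling "proceed without: cite as a named statement-only fact"), so the theorem NUMBER
  is that of the accepted version (`\newtheorem{thm}[prop]` numbered within sections: the first
  statement of §1 is Theorem 1.1) and journal page numbers inside 445–474 are not asserted. NB the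
  tree's earlier Kadiri file `KadiriDirichletExceptionalZero.lean` quotes arXiv **v1** (2005:
  all `q`, `R₀ = 6.3970`, at most one exceptional zero) — a DIFFERENT statement; see the erratum
  note there and in `ZeroFreeRegionUpTo.lean`.
  - Abstract (verbatim): "Let `L(s,χ)` be the Dirichlet `L`-function associated to a non-principal
    primitive character `χ` modulo `q` with `3 ≤ q ≤ 400 000`. We prove a new explicit zero-free
    region for `L(s,χ)`: `L(s,χ)` does not vanish in the region
    `Re s ≥ 1 − 1/(R log(q max(1,|Im s|)))` with `R = 5.60`. This improves a result of McCurley where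
    `9.65` was shown to be an admissible value for `R`."
  - **Theorem 1.1** (verbatim): "Let `q` be an integer with `3 ≤ q ≤ 400 000` and `χ` a non-principal
    primitive character modulo `q`. Then the Dirichlet `L`-function `L(s,χ)` does not vanish in the
    region: `Re s ≥ 1 − 1/(5.60 log(q max(1,|Im s|)))`." Followed by: "This result improves previous
    results of [Kad0] (`R = 6.436`) and [Mc2] (`R = 9.646`). The case `q > 400 000` will be treated
    in a follow-up article."
  - Inputs of the printed proof (§2 "Explicit results about the zeros of Dirichlet L-functions"):
    **Theorem 2.1** = Platt, Math. Comp. 85 (2016) Thm 7.1 ("GRH holds for Dirichlet `L`-functions of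
    primitive characters modulo `3 ≤ q ≤ 400 000` and to height
    `H_q = max(10⁸/q, c_q·10⁷/q + 200)` with `c_q = 7.5` if `q` is even and `3.75` otherwise") — the
    tree's named fact `platt2016_theorem71`; §3.1: "Let `q` be a modulus for which the verification
    of the GRH up to height `H_q` has been established. In this article, we use Theorem 2.1 and
    assume that `2 ≤ q ≤ 400 000`, `H_q > 293`, and `qH_q ≥ Q₀ = 10⁸`", the zero under attack having
    `γ₀ ≥ H_q`; **Theorem 2.2** = McCurley 1984 Thm 1 (`R = 9.645908801`, the starting region of the
    iteration `R → r`) — the tree's `McCurley1984_theorem1`; **Theorem 2.3** = Trudgian's explicit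
    `N(T,χ)` with `C₁ = 0.247`, `C₂ = 8.949`; §5.7 Tables 2–3: four certified rounds
    `9.6459 → 5.8579 → 5.6223 → 5.5992 → 5.5968` for `3 ≤ q ≤ 10³` and `10³ < q ≤ 4·10⁵`.
* M. A. Bennett, G. Martin, K. O'Bryant, A. Rechnitzer, *Explicit bounds for primes in arithmetic
  progressions*, Illinois J. Math. **62** (2018) 427–532 = arXiv:1802.00085 (held:
  `paper:arxiv-1802.00085`, chunks p0007, p0013, p0022, p0028) [BennettMartinOBryantRechnitzer2018]:
  - §2 (p0007): "`𝒵(χ) = {ρ ∈ ℂ : 0 < β < 1, L(ρ,χ) = 0}` … the set of zeros of `L(s,χ)` inside the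
    critical strip … does not include any zeros on the imaginary axis, even when `χ` is an
    imprimitive character; consequently, if `χ` is induced by another character `χ*`, then
    `𝒵(χ) = 𝒵(χ*)`."
  - **Definition 3.1** (p0013, verbatim): "Given positive real numbers `H₂` and `R`, we say that a
    character `χ` with conductor `q*` satisfies Hypothesis Z(`H₂,R`) if every nontrivial zero `β+iγ`
    of `L(s,χ)` satisfies either `|γ| ≤ H₂` and `β = ½`, or `|γ| > H₂` and
    `β ≤ 1 − 1/(R log(q*|γ|))`. … We say that a modulus `q` satisfies Hypothesis Z₁(`R`) if every
    nontrivial zero `β+iγ` of every Dirichlet `L`-function modulo `q` satisfies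
    `β ≤ 1 − 1/(R log(q max{1,|γ|}))`, except possibly for a single "exceptional" zero (which, as
    usual, will necessarily be a real zero of an `L`-function corresponding to a quadratic
    character—see [MV])."
  - **Proposition 4.34 (Platt, Kadiri, Mossinghoff–Trudgian)** (p0022, verbatim): "Let
    `1 ≤ q ≤ 10⁵`. Then `q` satisfies Hypothesis Z(`10⁸/q, 5.6`). Proof. By Definition 3.1 we need to
    confirm, for every Dirichlet `L`-function modulo `q`, that every nontrivial zero `β+iγ` with
    `|γ| ≤ 10⁸/q` satisfies `β = ½`, and that every nontrivial zero with `|γ| > 10⁸/q` satisfies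
    `β ≤ 1 − 1/(5.6 log(q|γ|))`. For the values of `q` under consideration, the first assertion was
    shown by Platt [Pla2], while the second assertion was shown by Kadiri [Ka] for `q ≥ 3` and by
    Mossinghoff and Trudgian [MoTr] for `q ∈ {1, 2}`. □" ([Ka] = Mathematika 64 (2018) 445–474;
    [MoTr] = J. Number Theory 157 (2015): no zeros of `ζ(σ+it)` for `|t| ≥ 2`,
    `σ > 1 − 1/(5.573412 log|t|)`; [Pla2] = Platt 2016.)
  - §6 p0028: "By work of McCurley [Mc1], we know that Hypothesis Z₁(9.645908801) holds".

## Contents and rendering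

* `kadiri2018_theorem11` — **named fact, Theorem 1.1 as printed**: for `3 ≤ q ≤ 400 000`, every
  PRIMITIVE `χ` mod `q` (primitive characters of such moduli are non-principal, the principal
  character having conductor `1`: tree `SiegelZeroQuality.ne_one_of_isPrimitive`) and every `s` with
  `1 − 1/(5.60 log(q·max(1,|Im s|))) ≤ Re s` (CLOSED region, as printed): `L(s,χ) ≠ 0`. No
  exclusion of `s = 1` is needed (`χ ≠ χ₀`, so Mathlib's `LFunction` is the genuine value there).
  `Kadiri2018ZFR.inRegion_iff`: the printed `q·max(1,|Im s|)` is the tree's `max(q, q|Im s|)`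
  (`Kadiri2018.InRegion 5.60 q s` of `KadiriDirichletExceptionalZero.lean`).
* PROVED around it: `kadiri2018_theorem11.of_ne_one` — the region transfers to EVERY non-principal
  `χ` mod `q ≤ 4·10⁵` (imprimitive included): `L(s,χ)` and `L(s,χ*)` have the same zeros off
  `Re s = 0` (`DirichletCharacter.LFunction_eq_zero_iff_primitiveCharacter`), the conductor `q*` of
  `χ ≠ χ₀` satisfies `3 ≤ q* ≤ q` (`q* ≠ 2`: `Kadiri2018ZFR.conductor_ne_two`), and the level-`q`
  region lies inside the level-`q*` region (`Kadiri2018ZFR.threshold_mono_level`); the region lies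
  to the right of `Re s = 1/2` (`Kadiri2018ZFR.half_lt_threshold`).
* `Kadiri2018ZFR.riemannZeta_ne_zero_of_threshold_lt` — the `ζ` input for the principal character:
  for `X ≥ 2`, `|Im s| ≤ X`, `R ≥ 5.558691` and `Re s > 1 − 1/(R log X)`, `ζ(s) ≠ 0`, from the
  Riemann hypothesis to height `3 000 175 332 800` (`platt_trudgian_numerical_rh`, Platt–Trudgian
  2021) below that height and the Mossinghoff–Trudgian–Yang region `5.558691` above it — the latter
  being PROVED in the tree from the former (`zero_free_region_mossinghoff_trudgian_yang_of_numerical_rh_only`,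
  `ExplicitZeroFreeRegionRoundsProofs.lean`), the only hypothesis is `platt_trudgian_numerical_rh`;
  `Kadiri2018ZFR.lfunction_one_ne_zero_of_threshold_lt`: the same for `L(s,χ₀) = ζ(s)∏_{p∣q}(1 − p^{−s})`.
* **`zeroFreeRegionUpTo_of_kadiri2018`**: `kadiri2018_theorem11 → platt_trudgian_numerical_rh →
  ∀ M₀ ≤ 3, ZeroFreeRegionUpTo 400000 5.60 M₀` — for `3 ≤ q ≤ 4·10⁵`, EVERY `χ` mod `q` and every
  `s ≠ 1` with `Re s > 1 − 1/(5.60 log max(q, q|Im s|))`: `L(s,χ) ≠ 0`. This is the column's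
  consumer C1 on Platt's range with the constant `5.60` in place of
  `zeroFreeRegionUpTo_platt_mccurley`'s `9.645908801` (which it implies: `…_mccurleyShape`).
* `BMOR2018.HypothesisZ χ H₂ R`, `BMOR2018.ModulusHypothesisZ q H₂ R` ("`q` satisfies Hypothesis
  Z(`H₂,R`)": every `χ` mod `q`, each with its own conductor `q*`, as the proof of Prop. 4.34 reads
  it), `BMOR2018.HypothesisZ₁ q R` (pair-rendering of "except possibly for a single zero": two
  violating pairs `(χ,ρ)` coincide; multiplicity not rendered) — Definition 3.1 with bodies;
  "nontrivial zero" = `L(ρ,χ) = 0 ∧ 0 < Re ρ < 1` (§2).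
* **`BMOR2018.modulusHypothesisZ_of_platt_kadiri`**: `platt2016_theorem71 → kadiri2018_theorem11 →
  platt_trudgian_numerical_rh →` for every `q ≤ 400 000`, `ModulusHypothesisZ q (10⁸/q) 5.6`; and
  **`BMOR2018.proposition434`** = the printed range `q ≤ 10⁵`. Proof as printed: below `10⁸/q` the
  zeros are on the line by Platt (`grhUpTo_of_platt2016`, imprimitive `χ` through `χ*`; the
  principal character — conductor `1`, the only one for `q ∈ {1,2}` — through `ζ` and
  `platt_trudgian_numerical_rh`, `10⁸/q ≤ 10⁸`); above `10⁸/q ≥ 250 > 1` the bound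
  `β ≤ 1 − 1/(5.6 log(q*|γ|))` is Kadiri's theorem at the conductor `q* ∈ [3, 4·10⁵]`
  (`max(1,|γ|) = |γ|`) or, for `q* = 1`, Mossinghoff–Trudgian(–Yang). RENDERING NOTE: the printed
  proof attributes the first assertion to "Platt [Pla2]" (= Platt 2016) for all `1 ≤ q ≤ 10⁵`; for
  the principal character (`ζ`) the input of record is a verification of RH to height `10⁸/q ≤ 10⁸`
  (the paper's own `H₂(1) = 30 610 046 000` is Platt 2017 [Pla3]); here `platt_trudgian_numerical_rh`.
* `BMOR2018.hypothesisZ₁_of_atMostOneZeroInRegion` (`AtMostOneZeroInRegion R M₀`, `M₀ ≤ q`) and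
  `BMOR2018.hypothesisZ₁_of_mccurley` (`McCurley1984_theorem1`, `q ≥ 10`: McCurley's floor
  `max{q, q|t|, 10}` is BMOR's `q max{1,|γ|}` exactly when `q ≥ 10`; BMOR use it for `q ≥ 10⁵`).

What is NOT here: a discharge of Theorem 1.1 (Kadiri's smoothed explicit formula with
Heath-Brown kernels, the generalised Stechkin device Prop. 5.2, Trudgian's `N(T,χ)`, four certified
rounds — size L; every input except the numerics has a tree counterpart for `ζ` in the
`KadiriStrip*`/`KadiriNumerics*` files, none for `L(s,χ)`); Kadiri's announced all-`q` sequel; the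
`ψ(x;q,a)` theorems of Bennett et al. that consume Prop. 4.34 (their Theorems 1.1–1.3; Lemma 6.12 is
the tree's `BMOR2018.lemma612_psi`).

## References

* H. Kadiri, Mathematika 64 (2018) 445–474 = arXiv:math/0510570v2, Theorem 1.1, §2 (Thms 2.1–2.3),
  §3.1, §5.7 Tables 2–3. [Kadiri2018]
* M. A. Bennett, G. Martin, K. O'Bryant, A. Rechnitzer, Illinois J. Math. 62 (2018) 427–532,
  §2 (`𝒵(χ)`), Definition 3.1, Proposition 4.34, §6 (Definition 6.1). [BennettMartinOBryantRechnitzer2018]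
* D. J. Platt, Math. Comp. 85 (2016) 3009–3027, Theorem 7.1 (journal Thm 10.1). [Platt2016GRH]
* D. Platt, T. Trudgian, Bull. Lond. Math. Soc. 53 (2021) 792–797, Theorem 1. [PlattTrudgian2021]
* M. J. Mossinghoff, T. S. Trudgian, J. Number Theory 157 (2015) 329–349, Theorem 1. [MossinghoffTrudgian2015]
* K. S. McCurley, J. Number Theory 19 (1984) 7–32, Theorem 1. [McCurley1984ZFR]
* H. L. Montgomery, R. C. Vaughan, *Multiplicative Number Theory I*, CUP 2007, §9.1 (conductor,
  induced modulus, primitive characters; no primitive character modulo `q ≡ 2 (mod 4)`). [MontgomeryVaughan2007]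
-/

noncomputable section

open Complex

namespace Literature.NumberTheory.LFunctions

/-! ### Kadiri 2018, Theorem 1.1 — the named fact -/

/-- **Kadiri 2018, Theorem 1.1 (as printed): "Let `q` be an integer with `3 ≤ q ≤ 400 000` and `χ`
a non-principal primitive character modulo `q`. Then the Dirichlet `L`-function `L(s,χ)` does not
vanish in the region: `Re s ≥ 1 − 1/(5.60 log(q max(1,|Im s|)))`."** Rendering: `χ` primitive
(hence non-principal, `q ≥ 3`); `L = DirichletCharacter.LFunction χ` (Mathlib; entire for `χ ≠ χ₀`,
so no point is excluded); the region is CLOSED, as printed. Proof in print: a smoothed explicit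
formula with a compactly supported weight `f = ηh(η·)` and Laplace-transform positivity, a
generalisation of Stechkin's device (Prop. 5.2), the degree-16 trigonometric polynomial of
Mossinghoff–Trudgian, Platt's verification of GRH to height `H_q` (the zero under attack has
`γ₀ ≥ H_q`, `qγ₀ ≥ 10⁸`), McCurley's region `R = 9.646` as the starting region, Trudgian's `N(T,χ)`,
and four certified numerical rounds `9.6459 → 5.8579 → 5.6223 → 5.5992 → 5.5968` (Tables 2–3); size
L, not discharged here. The case `q > 400 000` is announced for "a follow-up article" and is NOT
part of this statement. [cite: Kadiri2018, Theorem 1.1] -/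
def kadiri2018_theorem11 : Prop :=
  ∀ (q : ℕ) [NeZero q], 3 ≤ q → q ≤ 400000 →
    ∀ χ : DirichletCharacter ℂ q, χ.IsPrimitive →
      ∀ s : ℂ, 1 - 1 / (5.60 * Real.log ((q : ℝ) * max 1 |s.im|)) ≤ s.re → χ.LFunction s ≠ 0

namespace Kadiri2018ZFR

/-! ### Elementary facts about the region -/

/-- `q · max(1, |t|) = max(q, q|t|)` (`q ≥ 0`): the printed shape of the region equals the tree's
`Kadiri2018.InRegion` shape. [cite: Kadiri2018, Theorem 1.1] -/
theorem mul_max_one_abs (q : ℕ) (t : ℝ) : (q : ℝ) * max 1 |t| = max (q : ℝ) ((q : ℝ) * |t|) := by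
  rw [mul_max_of_nonneg _ _ (Nat.cast_nonneg q), mul_one]

/-- The printed region `Re s ≥ 1 − 1/(5.60 log(q max(1,|Im s|)))` is `Kadiri2018.InRegion 5.60 q s`
(`σ ≥ 1 − 1/(R₀ log max(q, q|t|))`, `KadiriDirichletExceptionalZero.lean`). [cite: Kadiri2018, Theorem 1.1] -/
theorem inRegion_iff {q : ℕ} {s : ℂ} :
    1 - 1 / (5.60 * Real.log ((q : ℝ) * max 1 |s.im|)) ≤ s.re ↔ Kadiri2018.InRegion 5.60 q s := by
  rw [Kadiri2018.InRegion, mul_max_one_abs]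

/-- `max(q, q|t|) ≥ 3` for `q ≥ 3`. [folklore] -/
private theorem three_le_max {q : ℕ} (hq : 3 ≤ q) (t : ℝ) : (3 : ℝ) ≤ max (q : ℝ) ((q : ℝ) * |t|) :=
  (show (3 : ℝ) ≤ q by exact_mod_cast hq).trans (le_max_left _ _)

/-- `|t| ≤ max(q, q|t|)` for `q ≥ 1`. [folklore] -/
private theorem abs_le_max {q : ℕ} (hq : 1 ≤ q) (t : ℝ) : |t| ≤ max (q : ℝ) ((q : ℝ) * |t|) := by
  have hq1 : (1 : ℝ) ≤ q := by exact_mod_cast hq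
  have : |t| ≤ (q : ℝ) * |t| := by nlinarith [abs_nonneg t]
  exact this.trans (le_max_right _ _)

/-- For `X ≥ 2` and `R ≥ 5.5` the threshold `1 − 1/(R log X)` exceeds `1/2` (`5.5 log 2 > 3.8 > 2`);
in particular the region lies in `Re s > 1/2`. [folklore] -/
private theorem half_lt_threshold {X R : ℝ} (hX : 2 ≤ X) (hR : 5.5 ≤ R) : 1 / 2 < 1 - 1 / (R * Real.log X) := by
  have hlog2 := Real.log_two_gt_d9
  have hlogX : Real.log 2 ≤ Real.log X := Real.log_le_log (by norm_num) hX
  have h2 : (2 : ℝ) < R * Real.log X := by nlinarith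
  have h : 1 / (R * Real.log X) < 1 / 2 := one_div_lt_one_div_of_lt (by norm_num) h2
  linarith

/-- Monotonicity of the threshold in the level: for `3 ≤ q' ≤ q` and `R > 0`,
`1 − 1/(R log max(q', q'|t|)) ≤ 1 − 1/(R log max(q, q|t|))` — the level-`q` region lies inside the
level-`q'` region (used with `q'` the conductor of an imprimitive character mod `q`). [folklore] -/
private theorem threshold_mono_level {q' q : ℕ} (hq' : 3 ≤ q') (hle : q' ≤ q) (t : ℝ) {R : ℝ} (hR : 0 < R) :
    1 - 1 / (R * Real.log (max (q' : ℝ) ((q' : ℝ) * |t|))) ≤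
      1 - 1 / (R * Real.log (max (q : ℝ) ((q : ℝ) * |t|))) := by
  have h3' := three_le_max hq' t
  have hle' : (q' : ℝ) ≤ q := by exact_mod_cast hle
  have hmax : max (q' : ℝ) ((q' : ℝ) * |t|) ≤ max (q : ℝ) ((q : ℝ) * |t|) :=
    max_le_max hle' (by nlinarith [abs_nonneg t])
  have hlog1 : 1 < Real.log (max (q' : ℝ) ((q' : ℝ) * |t|)) := by
    have hlog3 : 1 < Real.log 3 := by
      rw [Real.lt_log_iff_exp_lt (by norm_num)]
      linarith [Real.exp_one_lt_d9]
    exact hlog3.trans_le (Real.log_le_log (by norm_num) h3')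
  have hlog_le : Real.log (max (q' : ℝ) ((q' : ℝ) * |t|)) ≤ Real.log (max (q : ℝ) ((q : ℝ) * |t|)) :=
    Real.log_le_log (by linarith) hmax
  have h := one_div_le_one_div_of_le (mul_pos hR (by linarith : (0 : ℝ) < _))
    (mul_le_mul_of_nonneg_left hlog_le hR.le)
  linarith

/-! ### Characters: primitivity, conductor -/

/-- No Dirichlet character has conductor `2`: the unit group of `ZMod 2` is trivial, so the primitive
character inducing `χ` would be the principal character mod `2`, of conductor `1` (Montgomery–Vaughan
§9.1: no primitive character modulo `q ≡ 2 (mod 4)`). [cite: MontgomeryVaughan2007, §9.1] -/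
theorem conductor_ne_two {q : ℕ} [NeZero q] (χ : DirichletCharacter ℂ q) : χ.conductor ≠ 2 := by
  intro h2
  haveI : NeZero χ.conductor := ⟨χ.conductor_ne_zero⟩
  have hone : χ.primitiveCharacter = 1 := by
    refine MulChar.ext fun u ↦ ?_
    have hsub : Subsingleton (ZMod χ.conductor)ˣ := by
      refine Fintype.card_le_one_iff_subsingleton.mp ?_
      rw [ZMod.card_units_eq_totient, h2, Nat.totient_two]
    rw [Subsingleton.elim u 1, Units.val_one, map_one, map_one]
  have hc : χ.primitiveCharacter.conductor = χ.conductor := χ.primitiveCharacter_isPrimitive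
  rw [hone, DirichletCharacter.conductor_one] at hc
  omega

/-- The conductor `q*` of a non-principal character mod `q` satisfies `3 ≤ q* ≤ q` (`q* ∣ q`,
`q* ≠ 1, 2`; Montgomery–Vaughan §9.1). [cite: MontgomeryVaughan2007, §9.1] -/
theorem three_le_conductor_of_ne_one {q : ℕ} [NeZero q] {χ : DirichletCharacter ℂ q} (hχ : χ ≠ 1) :
    3 ≤ χ.conductor ∧ χ.conductor ≤ q := by
  have h1 := one_lt_conductor_of_ne_one hχ
  have h2 := conductor_ne_two χ
  exact ⟨by omega, Nat.le_of_dvd (Nat.pos_of_ne_zero (NeZero.ne q)) χ.conductor_dvd_level⟩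

/-! ### The `ζ` inputs for the principal character -/

/-- **The Riemann zeta inputs in Kadiri/BMOR shape.** Let `X ≥ 2`, `|Im s| ≤ X`, `R ≥ 5.558691` and
`Re s > 1 − 1/(R log X)`. Then `ζ(s) ≠ 0`: for `Re s ≥ 1` by non-vanishing on the `1`-line; for
`Im s = 0` because `ζ` has no real zero in `(0,1)`; for `0 < |Im s| ≤ 3 000 175 332 800` by the
numerical Riemann hypothesis (`Re s = 1/2 < 1 − 1/(R log X)`); above that height by the
Mossinghoff–Trudgian–Yang region `1 − 1/(5.558691 log|t|) ≥ 1 − 1/(R log X)`, itself proved in the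
tree from the numerical RH. [cite: PlattTrudgian2021, Theorem 1]
[cite: BennettMartinOBryantRechnitzer2018, Proposition 4.34 (proof: "[MoTr] for q ∈ {1,2}")] -/
theorem riemannZeta_ne_zero_of_threshold_lt (hA : platt_trudgian_numerical_rh) {s : ℂ} {X R : ℝ}
    (hX : 2 ≤ X) (htX : |s.im| ≤ X) (hR : 5.558691 ≤ R) (hr : 1 - 1 / (R * Real.log X) < s.re) :
    riemannZeta s ≠ 0 := by
  by_cases h1 : 1 ≤ s.re
  · exact riemannZeta_ne_zero_of_one_le_re h1
  rw [not_le] at h1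
  have hhalf : 1 / 2 < s.re := (half_lt_threshold hX (by linarith)).trans hr
  intro hz
  by_cases him : s.im = 0
  · exact riemannZeta_ne_zero_of_im_eq_zero_of_pos_of_lt_one him (by linarith) h1 hz
  rcases le_or_gt |s.im| 3000175332800 with hlow | hhigh
  · -- numerical RH: `Re s = 1/2`
    have hre : s.re = 1 / 2 := by
      rcases lt_or_gt_of_ne him with hneg | hpos
      · have hz' : riemannZeta (starRingEnd ℂ s) = 0 := by rw [riemannZeta_conj, hz, map_zero]
        have h := hA (starRingEnd ℂ s) hz' (by simpa using hneg)
          (by simpa [abs_of_neg hneg] using hlow)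
        simpa using h
      · exact hA s hz hpos (by simpa [abs_of_pos hpos] using hlow)
    linarith
  · -- Mossinghoff–Trudgian–Yang above the RH height
    have hZ := zero_free_region_mossinghoff_trudgian_yang_of_numerical_rh_only hA
    have hγ2 : (2 : ℝ) ≤ |s.im| := by linarith
    have hlogγ : 0 < Real.log |s.im| := Real.log_pos (by linarith)
    have hlog_le : Real.log |s.im| ≤ Real.log X := Real.log_le_log (by linarith) htX
    have hcmp : 1 - 1 / (5.558691 * Real.log |s.im|) ≤ 1 - 1 / (R * Real.log X) := by
      have h := one_div_le_one_div_of_le (mul_pos (by norm_num : (0 : ℝ) < 5.558691) hlogγ)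
        (mul_le_mul hR hlog_le hlogγ.le (by linarith))
      linarith
    have hne := hZ s.re s.im hγ2 (hcmp.trans hr.le)
    rw [Complex.re_add_im] at hne
    exact hne hz

/-- The same for the principal character mod `q`: `L(s,χ₀) = ζ(s)∏_{p∣q}(1 − p^{−s})`
(Mathlib `DirichletCharacter.LFunctionTrivChar_eq_mul_riemannZeta`, `s ≠ 1`), the Euler factors
not vanishing for `Re s > 0`. [cite: BennettMartinOBryantRechnitzer2018, §2 ("𝒵(χ) does not include
any zeros on the imaginary axis … 𝒵(χ) = 𝒵(χ*)")] -/
theorem lfunction_one_ne_zero_of_threshold_lt (hA : platt_trudgian_numerical_rh) {q : ℕ} [NeZero q]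
    {s : ℂ} {X R : ℝ} (hX : 2 ≤ X) (htX : |s.im| ≤ X) (hR : 5.558691 ≤ R) (hs1 : s ≠ 1)
    (hr : 1 - 1 / (R * Real.log X) < s.re) : (1 : DirichletCharacter ℂ q).LFunction s ≠ 0 := by
  have hre : 0 < s.re := by linarith [half_lt_threshold hX (by linarith : (5.5 : ℝ) ≤ R)]
  change DirichletCharacter.LFunctionTrivChar q s ≠ 0
  rw [DirichletCharacter.LFunctionTrivChar_eq_mul_riemannZeta hs1]
  refine mul_ne_zero (Finset.prod_ne_zero_iff.mpr fun p hp ↦ ?_)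
    (riemannZeta_ne_zero_of_threshold_lt hA hX htX hR hr)
  have hp := Nat.prime_of_mem_primeFactors hp
  have hlt : ‖(p : ℂ) ^ (-s)‖ < 1 := by
    rw [Complex.norm_natCast_cpow_of_pos hp.pos, Complex.neg_re]
    exact Real.rpow_lt_one_of_one_lt_of_neg (by exact_mod_cast hp.one_lt) (by linarith)
  rw [sub_ne_zero]
  intro h
  rw [← h, norm_one] at hlt
  exact lt_irrefl _ hlt

end Kadiri2018ZFR

/-! ### Kadiri's region for every non-principal character of modulus `≤ 4·10⁵` -/

open Kadiri2018ZFR in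
/-- **Kadiri's Theorem 1.1 for all non-principal characters** (imprimitive included): if `χ ≠ χ₀`
mod `q ≤ 400 000` and `1 − 1/(5.60 log(q max(1,|Im s|))) ≤ Re s`, then `L(s,χ) ≠ 0`. Proof: for
`Re s ≥ 1` this is classical non-vanishing; otherwise `0 < Re s < 1` (the region lies right of `1/2`),
the zeros of `L(s,χ)` there are those of `L(s,χ*)` for the primitive `χ*` of conductor
`3 ≤ q* ≤ q ≤ 4·10⁵`, and the level-`q` region lies in the level-`q*` region.
[cite: Kadiri2018, Theorem 1.1] [cite: BennettMartinOBryantRechnitzer2018, §2 ("𝒵(χ) = 𝒵(χ*)")] -/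
theorem kadiri2018_theorem11.of_ne_one (hK : kadiri2018_theorem11) {q : ℕ} [NeZero q]
    (hq : q ≤ 400000) {χ : DirichletCharacter ℂ q} (hχ : χ ≠ 1) {s : ℂ}
    (hr : 1 - 1 / (5.60 * Real.log ((q : ℝ) * max 1 |s.im|)) ≤ s.re) : χ.LFunction s ≠ 0 := by
  by_cases h1 : 1 ≤ s.re
  · exact χ.LFunction_ne_zero_of_one_le_re (Or.inl hχ) h1
  rw [not_le] at h1
  obtain ⟨hc3, hcq⟩ := three_le_conductor_of_ne_one hχ
  have hq3 : 3 ≤ q := hc3.trans hcq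
  rw [mul_max_one_abs] at hr
  have hhalf : 1 / 2 < s.re :=
    (half_lt_threshold ((by norm_num : (2 : ℝ) ≤ 3).trans (three_le_max hq3 s.im))
      (by norm_num)).trans_le hr
  have hs1 : s ≠ 1 := fun h ↦ by rw [h, Complex.one_re] at h1; exact lt_irrefl _ h1
  haveI : NeZero χ.conductor := ⟨χ.conductor_ne_zero⟩
  intro hz
  have hz' : χ.primitiveCharacter.LFunction s = 0 :=
    (χ.LFunction_eq_zero_iff_primitiveCharacter (by linarith) hs1).1 hz
  refine hK χ.conductor hc3 (hcq.trans hq) χ.primitiveCharacter χ.primitiveCharacter_isPrimitive s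
    ?_ hz'
  rw [mul_max_one_abs]
  exact (threshold_mono_level hc3 hcq s.im (by norm_num)).trans hr

open Kadiri2018ZFR in
/-- **The column's exception-free region on Platt's range with Kadiri's constant**:
`kadiri2018_theorem11 → platt_trudgian_numerical_rh → ZeroFreeRegionUpTo 400000 5.60 M₀` for every
floor `M₀ ≤ 3` (idle, since `q ≥ 3`) — for `3 ≤ q ≤ 4·10⁵`, EVERY Dirichlet character `χ` mod `q`
(principal and imprimitive included) and every `s ≠ 1` with `Re s > 1 − 1/(5.60 log max(q, q|Im s|))`:
`L(s,χ) ≠ 0`. Non-principal `χ`: `kadiri2018_theorem11.of_ne_one`; principal `χ`: the `ζ` inputs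
(`Kadiri2018ZFR.lfunction_one_ne_zero_of_threshold_lt` with `X = max(q, q|Im s|) ≥ |Im s|`,
`5.558691 ≤ 5.60`). [cite: Kadiri2018, Theorem 1.1]
[cite: BennettMartinOBryantRechnitzer2018, Proposition 4.34] -/
theorem zeroFreeRegionUpTo_of_kadiri2018 (hK : kadiri2018_theorem11) (hA : platt_trudgian_numerical_rh)
    {M₀ : ℝ} (hM₀ : M₀ ≤ 3) : ZeroFreeRegionUpTo 400000 5.60 M₀ := by
  intro q _ hq3 hqQ χ s hs1 hr
  have hq3r : (3 : ℝ) ≤ q := by exact_mod_cast hq3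
  have hmax : max (max (q : ℝ) ((q : ℝ) * |s.im|)) M₀ = max (q : ℝ) ((q : ℝ) * |s.im|) :=
    max_eq_left (hM₀.trans (hq3r.trans (le_max_left _ _)))
  rw [hmax] at hr
  by_cases hχ : χ = 1
  · subst hχ
    exact lfunction_one_ne_zero_of_threshold_lt hA ((by norm_num : (2 : ℝ) ≤ 3).trans
      (three_le_max hq3 s.im)) (abs_le_max (by omega) s.im) (by norm_num) hs1 hr
  · refine hK.of_ne_one hqQ hχ ?_
    rw [mul_max_one_abs]
    exact hr.le

/-- In particular the conclusion of `zeroFreeRegionUpTo_platt_mccurley`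
(`ZeroFreeRegionUpTo 400000 9.645908801 10`, there from Platt 2016 + McCurley 1984) also follows
from Kadiri 2018 + Platt–Trudgian 2021, the region with `R = 5.60` and no floor being the larger
one (`ZeroFreeRegionUpTo.mono`). [cite: Kadiri2018, Theorem 1.1 ("This result improves … [Mc2] (R = 9.646)")] -/
theorem zeroFreeRegionUpTo_mccurleyShape_of_kadiri2018 (hK : kadiri2018_theorem11)
    (hA : platt_trudgian_numerical_rh) : ZeroFreeRegionUpTo 400000 9.645908801 10 :=
  (zeroFreeRegionUpTo_of_kadiri2018 hK hA le_rfl).mono (by norm_num) (by norm_num) (by norm_num)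

/-! ### Bennett–Martin–O'Bryant–Rechnitzer, Definition 3.1 and Proposition 4.34 -/

namespace BMOR2018

/-- **Bennett–Martin–O'Bryant–Rechnitzer 2018, Definition 3.1 (first part, as printed): "Given
positive real numbers `H₂` and `R`, we say that a character `χ` with conductor `q*` satisfies
Hypothesis Z(`H₂,R`) if every nontrivial zero `β+iγ` of `L(s,χ)` satisfies either `|γ| ≤ H₂` and
`β = ½`, or `|γ| > H₂` and `β ≤ 1 − 1/(R log(q*|γ|))`."** Nontrivial zeros are those of
`𝒵(χ) = {ρ : 0 < β < 1, L(ρ,χ) = 0}` (op. cit. §2); `q* = χ.conductor` (Mathlib).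
[cite: BennettMartinOBryantRechnitzer2018, Definition 3.1] -/
def HypothesisZ {q : ℕ} [NeZero q] (χ : DirichletCharacter ℂ q) (H₂ R : ℝ) : Prop :=
  ∀ ρ : ℂ, χ.LFunction ρ = 0 → 0 < ρ.re → ρ.re < 1 →
    (|ρ.im| ≤ H₂ ∧ ρ.re = 1 / 2) ∨
      (H₂ < |ρ.im| ∧ ρ.re ≤ 1 - 1 / (R * Real.log ((χ.conductor : ℝ) * |ρ.im|)))

/-- **"`q` satisfies Hypothesis Z(`H₂,R`)"** in the sense of Proposition 4.34 and of the hypotheses of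
the §4 theorems it feeds ("every character `χ` with modulus `q` satisfies Hypothesis Z(`H₂(q*),R)`,
where `q*` is the conductor of `χ`", here with a height `H₂` not depending on `q*`): every Dirichlet
character mod `q`, principal and imprimitive included, satisfies `HypothesisZ χ H₂ R` (each with its
own conductor inside the logarithm). [cite: BennettMartinOBryantRechnitzer2018, Proposition 4.34 (proof, first sentence)] -/
def ModulusHypothesisZ (q : ℕ) [NeZero q] (H₂ R : ℝ) : Prop :=
  ∀ χ : DirichletCharacter ℂ q, HypothesisZ χ H₂ R

/-- **Bennett–Martin–O'Bryant–Rechnitzer 2018, Definition 3.1 (second part, as printed): "We say that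
a modulus `q` satisfies Hypothesis Z₁(`R`) if every nontrivial zero `β+iγ` of every Dirichlet
`L`-function modulo `q` satisfies `β ≤ 1 − 1/(R log(q max{1,|γ|}))`, except possibly for a single
"exceptional" zero (which, as usual, will necessarily be a real zero of an `L`-function corresponding
to a quadratic character—see [MV])."** Rendered on pairs, as the tree's `AtMostOneZeroInRegion`:
two violating pairs `(χ₁,ρ₁)`, `(χ₂,ρ₂)` (nontrivial zeros with `β > 1 − 1/(R log(q max{1,|γ|}))`)
coincide. The multiplicity reading of "single" (simplicity) and the parenthetical consequence are
not part of the definition. [cite: BennettMartinOBryantRechnitzer2018, Definition 3.1] -/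
def HypothesisZ₁ (q : ℕ) [NeZero q] (R : ℝ) : Prop :=
  ∀ (χ₁ χ₂ : DirichletCharacter ℂ q) (ρ₁ ρ₂ : ℂ),
    χ₁.LFunction ρ₁ = 0 → 0 < ρ₁.re → ρ₁.re < 1 →
      1 - 1 / (R * Real.log ((q : ℝ) * max 1 |ρ₁.im|)) < ρ₁.re →
    χ₂.LFunction ρ₂ = 0 → 0 < ρ₂.re → ρ₂.re < 1 →
      1 - 1 / (R * Real.log ((q : ℝ) * max 1 |ρ₂.im|)) < ρ₂.re →
    χ₁ = χ₂ ∧ ρ₁ = ρ₂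

/-- `HypothesisZ` is monotone in `R` on `R > 0` when `|γ| > H₂ ≥ 1` forces `log(q*|γ|) ≥ 0`: a larger
constant is a weaker demand — from `R` to any `R' ≥ R > 0`, provided `1 ≤ H₂`. [cite: BennettMartinOBryantRechnitzer2018, Definition 3.1] -/
theorem HypothesisZ.mono {q : ℕ} [NeZero q] {χ : DirichletCharacter ℂ q} {H₂ R R' : ℝ}
    (h : HypothesisZ χ H₂ R) (hH : 1 ≤ H₂) (hR : 0 < R) (hRR : R ≤ R') : HypothesisZ χ H₂ R' := by
  intro ρ hz h0 h1
  rcases h ρ hz h0 h1 with hl | ⟨hγ, hβ⟩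
  · exact Or.inl hl
  · refine Or.inr ⟨hγ, hβ.trans ?_⟩
    have hc1 : (1 : ℝ) ≤ χ.conductor := by
      exact_mod_cast Nat.one_le_iff_ne_zero.mpr χ.conductor_ne_zero
    have hlog : 0 ≤ Real.log ((χ.conductor : ℝ) * |ρ.im|) :=
      Real.log_nonneg (by nlinarith)
    rcases hlog.eq_or_lt with hlog0 | hlogpos
    · rw [← hlog0]; simp
    have := one_div_le_one_div_of_le (mul_pos hR hlogpos) (mul_le_mul_of_nonneg_right hRR hlogpos.le)
    linarith

open Kadiri2018ZFR in
/-- **Hypothesis Z(`10⁸/q, 5.6`) for every modulus `q ≤ 400 000, DERIVED** from Platt 2016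
(`platt2016_theorem71`), Kadiri 2018 (`kadiri2018_theorem11`) and the numerical Riemann hypothesis
of Platt–Trudgian 2021 (`platt_trudgian_numerical_rh`, which also yields the Mossinghoff–Trudgian(–Yang)
region for `ζ` in the tree). Proof as printed for Prop. 4.34: a nontrivial zero `ρ = β+iγ` of
`L(s,χ)`, `χ` mod `q` of conductor `q*`, with `|γ| ≤ 10⁸/q` has `β = ½` — by Platt at the
conductor when `χ ≠ χ₀` (`grhUpTo_of_platt2016`), by RH to height `10⁸/q ≤ 10⁸ ≤ 3·10¹²` for `ζ`
when `χ = χ₀` (`L(s,χ₀) = ζ(s)∏(1 − p^{−s})`); with `|γ| > 10⁸/q ≥ 250 > 1` it has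
`β ≤ 1 − 1/(5.6 log(q*|γ|))` — by Kadiri at the conductor `3 ≤ q* ≤ q` (`max(1,|γ|) = |γ|`) when
`χ ≠ χ₀`, and by the `ζ` region when `q* = 1` (`X = |γ| ≥ 2`, `5.558691 ≤ 5.6`).
[cite: BennettMartinOBryantRechnitzer2018, Proposition 4.34] [cite: Kadiri2018, Theorem 1.1]
[cite: Platt2016GRH, Theorem 10.1 p. 3026 (journal) = arXiv:1305.3087v1 Theorem 7.1]
[cite: PlattTrudgian2021, Theorem 1] -/
theorem modulusHypothesisZ_of_platt_kadiri (hP : platt2016_theorem71) (hK : kadiri2018_theorem11)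
    (hA : platt_trudgian_numerical_rh) {q : ℕ} [NeZero q] (hq : q ≤ 400000) :
    ModulusHypothesisZ q (10 ^ 8 / q) 5.6 := by
  intro χ ρ hz h0 h1
  have hq0 : (0 : ℝ) < q := by exact_mod_cast Nat.pos_of_ne_zero (NeZero.ne q)
  have hqr : (q : ℝ) ≤ 400000 := by exact_mod_cast hq
  have hH : (250 : ℝ) ≤ 10 ^ 8 / q := by
    rw [le_div_iff₀ hq0]; nlinarith
  have hρ1 : ρ ≠ 1 := fun h ↦ by rw [h, Complex.one_re] at h1; exact lt_irrefl _ h1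
  by_cases hγ : |ρ.im| ≤ 10 ^ 8 / q
  · -- below the verification height: the zero is on the critical line
    refine Or.inl ⟨hγ, ?_⟩
    by_cases hχ : χ = 1
    · -- principal character: `ζ`
      subst hχ
      have hζ : riemannZeta ρ = 0 := by
        have h := hz
        change DirichletCharacter.LFunctionTrivChar q ρ = 0 at h
        rw [DirichletCharacter.LFunctionTrivChar_eq_mul_riemannZeta hρ1, mul_eq_zero] at h
        rcases h with hprod | hζ
        · exfalso
          obtain ⟨p, hp, hp0⟩ := Finset.prod_eq_zero_iff.mp hprod
          have hpp := Nat.prime_of_mem_primeFactors hp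
          have hlt : ‖(p : ℂ) ^ (-ρ)‖ < 1 := by
            rw [Complex.norm_natCast_cpow_of_pos hpp.pos, Complex.neg_re]
            exact Real.rpow_lt_one_of_one_lt_of_neg (by exact_mod_cast hpp.one_lt) (by linarith)
          rw [sub_eq_zero] at hp0
          rw [← hp0, norm_one] at hlt
          exact lt_irrefl _ hlt
        · exact hζ
      have him : ρ.im ≠ 0 := fun him ↦
        riemannZeta_ne_zero_of_im_eq_zero_of_pos_of_lt_one him h0 h1 hζ
      have hlow : |ρ.im| ≤ 3000175332800 := by
        refine hγ.trans ?_
        rw [div_le_iff₀ hq0]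
        have hq1 : (1 : ℝ) ≤ q := by exact_mod_cast Nat.pos_of_ne_zero (NeZero.ne q)
        nlinarith
      rcases lt_or_gt_of_ne him with hneg | hpos
      · have hz' : riemannZeta (starRingEnd ℂ ρ) = 0 := by rw [riemannZeta_conj, hζ, map_zero]
        have h := hA (starRingEnd ℂ ρ) hz' (by simpa using hneg)
          (by simpa [abs_of_neg hneg] using hlow)
        simpa using h
      · exact hA ρ hζ hpos (by simpa [abs_of_pos hpos] using hlow)
    · -- non-principal character: Platt at the conductor
      exact grhUpTo_of_platt2016 hP hq χ hχ ρ hz h0 h1 hγ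
  · -- above the verification height: the explicit region
    rw [not_le] at hγ
    refine Or.inr ⟨hγ, ?_⟩
    have hγ1 : (250 : ℝ) < |ρ.im| := hH.trans_lt hγ
    by_contra hlt
    rw [not_le] at hlt
    by_cases hχ : χ = 1
    · -- conductor `1`: the `ζ` region with `X = |γ|`
      subst hχ
      rw [DirichletCharacter.conductor_one, Nat.cast_one, one_mul] at hlt
      exact lfunction_one_ne_zero_of_threshold_lt hA (X := |ρ.im|) (by linarith) le_rfl
        (by norm_num) hρ1 hlt hz
    · -- conductor `3 ≤ q* ≤ q`: Kadiri at the conductor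
      obtain ⟨hc3, hcq⟩ := three_le_conductor_of_ne_one hχ
      haveI : NeZero χ.conductor := ⟨χ.conductor_ne_zero⟩
      have hz' : χ.primitiveCharacter.LFunction ρ = 0 :=
        (χ.LFunction_eq_zero_iff_primitiveCharacter h0 hρ1).1 hz
      refine hK χ.conductor hc3 (hcq.trans hq) χ.primitiveCharacter
        χ.primitiveCharacter_isPrimitive ρ ?_ hz'
      rw [max_eq_right (by linarith : (1 : ℝ) ≤ |ρ.im|), show (5.60 : ℝ) = 5.6 by norm_num]
      exact hlt.le

/-- **Bennett–Martin–O'Bryant–Rechnitzer 2018, Proposition 4.34 ("Platt, Kadiri, Mossinghoff–Trudgian";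
as printed): "Let `1 ≤ q ≤ 10⁵`. Then `q` satisfies Hypothesis Z(`10⁸/q, 5.6`)."** — DERIVED from
the three instrument facts its proof quotes (Platt 2016 for the zeros below `10⁸/q`, Kadiri 2018
for the region when `q* ≥ 3`, and, for the conductor-`1` character, the `ζ` inputs: here the numerical
RH of Platt–Trudgian 2021, which gives both RH to height `10⁸/q` and, in the tree, the
Mossinghoff–Trudgian region). The instance `q ≤ 10⁵` of `modulusHypothesisZ_of_platt_kadiri`.
[cite: BennettMartinOBryantRechnitzer2018, Proposition 4.34] -/
theorem proposition434 (hP : platt2016_theorem71) (hK : kadiri2018_theorem11)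
    (hA : platt_trudgian_numerical_rh) {q : ℕ} [NeZero q] (hq : q ≤ 100000) :
    ModulusHypothesisZ q (10 ^ 8 / q) 5.6 :=
  modulusHypothesisZ_of_platt_kadiri hP hK hA (hq.trans (by norm_num))

/-! ### Hypothesis Z₁ from an at-most-one-zero theorem (McCurley) -/

open Kadiri2018ZFR in
/-- **Hypothesis Z₁(`R`) from an at-most-one-zero theorem with an idle floor.** If
`AtMostOneZeroInRegion R M₀` holds (`ZeroFreeRegionUpTo.lean`: at most one pair `(χ,s)`, `s ≠ 1`,
`q ≥ 3`, in `σ > 1 − 1/(R log max{q, q|t|, M₀})`) and `M₀ ≤ q`, then `q` satisfies Hypothesis Z₁(`R`):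
for `M₀ ≤ q` the floor is idle and `max{q, q|t|} = q max{1,|t|}`, and a nontrivial zero has `s ≠ 1`.
[cite: BennettMartinOBryantRechnitzer2018, Definition 3.1] [cite: McCurley1984ZFR, Theorem 1] -/
theorem hypothesisZ₁_of_atMostOneZeroInRegion {R M₀ : ℝ} (h : AtMostOneZeroInRegion R M₀) {q : ℕ}
    [NeZero q] (hq3 : 3 ≤ q) (hM₀ : M₀ ≤ q) : HypothesisZ₁ q R := by
  intro χ₁ χ₂ ρ₁ ρ₂ hz₁ h0₁ h1₁ hr₁ hz₂ h0₂ h1₂ hr₂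
  have hne : ∀ ρ : ℂ, ρ.re < 1 → ρ ≠ 1 := fun ρ h e ↦ by
    rw [e, Complex.one_re] at h; exact lt_irrefl _ h
  have hfloor : ∀ t : ℝ, max (max (q : ℝ) ((q : ℝ) * |t|)) M₀ = (q : ℝ) * max 1 |t| := fun t ↦ by
    rw [mul_max_one_abs, max_eq_left (hM₀.trans (le_max_left _ _))]
  exact (h q hq3 χ₁ χ₂ ρ₁ ρ₂ (hne ρ₁ h1₁) (hne ρ₂ h1₂) (by rw [hfloor]; exact hr₁)
    (by rw [hfloor]; exact hr₂) hz₁ hz₂).1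

/-- **"By work of McCurley [Mc1], we know that Hypothesis Z₁(9.645908801) holds"** (Bennett et al.
§6, before Definition 6.1; used there for `q ≥ 10⁵`) — DERIVED from the tree's `McCurley1984_theorem1`
for every modulus `q ≥ 10` (McCurley's floor `max{q, q|t|, 10}` is then BMOR's `q max{1,|γ|}`).
[cite: BennettMartinOBryantRechnitzer2018, §6 (text before Definition 6.1)] [cite: McCurley1984ZFR, Theorem 1] -/
theorem hypothesisZ₁_of_mccurley (hM : McCurley1984_theorem1) {q : ℕ} [NeZero q] (hq : 10 ≤ q) :
    HypothesisZ₁ q 9.645908801 :=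
  hypothesisZ₁_of_atMostOneZeroInRegion hM (by omega) (by exact_mod_cast hq)

end BMOR2018

end Literature.NumberTheory.LFunctions

end
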